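import Summits.HodgeConjecture.HodgeConjecture.Cruxes.BlochSeedDiscOne.PortHallLegSurplus
import Summits.HodgeConjecture.HodgeConjecture.Cruxes.BlochSeedDiscOne.PatternedPorteous

/-!
line stmt-HodgeConjecture-18881 Cruxes/BlochSeedDiscOne/Lines/birth.lean 814a6a70c14e831a stub_rung_pad4_seedAt

# PortHallStarRow — the STAR sub-row of PortHall₈ (the part that is THEOREM-grade on leg-free split blocks) and a leg-free NON-STAR
# pattern `D3` on which PortHall₈'s pair condition is decided by LAW PP, not by the star theorem
(planner `plan-lens-HodgeAV-negation` g26, 2026-08-31; sequel of `PortHallLegSurplus.lean`; memo `PORTHALL8-ROW-A2-negation-g26.md` §2 T2′, §4;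
answers director-hodge R19.846 (2): «the exact lemma shape toward `Rung2b` row 6, or why only the uniform-leg ∕ four-ample cases are theorem-grade».)

STATUS ∕ SCOPE.  Letter-model statements about `DepthBoundA4.Design` only; NOTHING here is proved toward HC ∕ HC_CM ∕ HC_AV ∕ №4 ∕ 26512 ∕ 18881 ∕
H2; no stub of any skeleton is registered or touched.  Imports BUILT modules only (`PortHallLegSurplus`, and hsemireg-monad-3 g16's
`PatternedPorteous` for the four-ample `Bool` test `liveB_iff` and the kernel LAW-PP engine `ppCleanB ∕ portHallB ∕ hallMargin`); no `axiom`, no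
`instance`, no notation, no `sorry`, no `native_decide`; `decide` ∕ `decide +kernel` on closed terms of ≤ 15 cells.

THE PEN FACT THIS FILE TYPES THE LETTER SIDE OF (memo §2 T2′; [cite: Fulton1998, §12.1 p.206 «any quotient bundle of an ample bundle is ample»
and Example 12.1.6]): let `φ : ⊕_P L_σ^m → ⊕_N L_τ^n` be injective at every point of `X = S⁴` (cokernel locally free), with letter Hom-vanishing
(dead pairs are zero entries) and every weakly-live entry pair four-AMPLE (`PortHallLeg.EntrySharp`).  If a column set `S` has a STAR — a column
`σ⋆ ∈ S` of positive multiplicity weakly live below EVERY receiver of `S` — then `Σ_S m + 8 ≤ Σ_{T(S)} n`: the quotient `W_{T(S)} ∕ φ(V_{S ∖ σ⋆})` is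
locally free, `V_{σ⋆}` injects into it at every point, and `Hom(V_{σ⋆}, —)` of it is a quotient of the AMPLE bundle `⊕_{τ ∈ T(S)} Hom(L_{σ⋆}, L_τ)^{n m⋆}`,
so Fulton–Lazarsfeld applies.  Hence `HallPlusStarUp · 8` below is THEOREM-grade on leg-free split blocks; singletons are stars, so every
ONE-COLUMN condition of PortHall₈ is covered, and on designs with NESTED receiver sets the star row IS PortHall₈.  What is NOT covered: column
sets without a star (§2's `D3`: two columns with crossing private receivers).  There PortHall₈'s extra condition is EXPECTED (dimension count)
and is CONFIRMED design by design by LAW PP's digit (kernel: `D3_kernel` — PP refutes `D3`, whose only PortHall₈ violation is the non-star pair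
condition), but a proof for all leg-free patterns (positivity of patterned Porteous digits) is not claimed.
-/

set_option linter.dupNamespace false
set_option autoImplicit false
set_option maxRecDepth 8192
set_option maxHeartbeats 4000000

namespace Summit.HodgeConjecture.HodgeConjecture.Cruxes.BlochSeedDiscOne.PortHallLeg

open Summit.HodgeConjecture.HodgeConjecture.Cruxes.BlochSeedDiscOne.DepthBoundA4
open Summit.HodgeConjecture.HodgeConjecture.Cruxes.BlochSeedDiscOne.LeggedFloor
open Summit.HodgeConjecture.HodgeConjecture.Cruxes.BlochSeedDiscOne.HallB136
open Summit.HodgeConjecture.HodgeConjecture.Cruxes.BlochSeedDiscOne.RuleDPlate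
open Summit.HodgeConjecture.HodgeConjecture.Cruxes.BlochSeedDiscOne.PatternedPorteous
  (liveB liveB_iff weakB ppCleanB portHallB hallMargin PPClean PortHall)

/-! ## §1 The star sub-row -/

/-- `S` has a STAR: an entry of positive multiplicity whose cell is weakly live below every N-entry that is weakly live above some entry of `S`. -/
def StarBelow (E : Design) (S : List (Cell × ℕ)) : Prop :=
  ∃ cs ∈ S, 0 < cs.2 ∧ ∀ cn ∈ E.N, (∃ cm ∈ S, WeakLive cm.1 cn.1) → WeakLive cs.1 cn.1

/-- **STAR SURPLUS ROW `HallPlusStarUp E k`**: PortHall_k's condition demanded only of column sets with a star.  For `k = 8` this is the part of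
PortHall₈ that Fulton–Lazarsfeld + the quotient trick prove on leg-free split blocks (module docstring). -/
def HallPlusStarUp (E : Design) (k : ℕ) : Prop :=
  ∀ S : List (Cell × ℕ), S.Sublist E.P → 0 < (S.map Prod.snd).sum → StarBelow E S →
    ∀ T : List (Cell × ℕ), T.Sublist E.N → (∀ cn ∈ E.N, (∃ cm ∈ S, WeakLive cm.1 cn.1) → cn ∈ T) →
      (S.map Prod.snd).sum + k ≤ (T.map Prod.snd).sum

theorem hallPlusStarUp_of_hallPlusUp (E : Design) (k : ℕ) (h : HallPlusUp E k) : HallPlusStarUp E k :=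
  fun S hS hpos _ T hT hcov => h S hS hpos T hT hcov

theorem hallPlusStarUp_mono (E : Design) {j k : ℕ} (hjk : j ≤ k) (h : HallPlusStarUp E k) : HallPlusStarUp E j :=
  fun S hS hpos hst T hT hcov => le_trans (Nat.add_le_add_left hjk _) (h S hS hpos hst T hT hcov)

/-- singletons of positive multiplicity are stars: every ONE-COLUMN condition of PortHall_k is a star condition. -/
theorem starBelow_singleton (E : Design) (c : Cell) {m : ℕ} (hm : 0 < m) : StarBelow E [(c, m)] :=
  ⟨(c, m), List.mem_singleton.2 rfl, hm, fun cn _ hex => by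
    obtain ⟨cm, hcm, hw⟩ := hex
    rw [List.mem_singleton] at hcm
    subst hcm
    exact hw⟩

/-- the star row at `0` still contains nothing new: it follows from `HallUp` (which has no star restriction). -/
theorem hallPlusStarUp_zero_of_hallUp (E : Design) (h : HallUp E) : HallPlusStarUp E 0 :=
  hallPlusStarUp_of_hallPlusUp E 0 ((hallUp_iff_hallPlusUp_zero E).1 h)

/-- `C1` (null leg) violates even the star row at every surplus `≥ 2`: its violating column set is a singleton.  (Legged: the star THEOREM does
not apply — `C1` is not `EntrySharp`.) -/
theorem not_hallPlusStarUp_C1 {k : ℕ} (hk : 2 ≤ k) : ¬ HallPlusStarUp C1 k := by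
  intro h
  have h1 := h C1.P (List.Sublist.refl _) (by decide) (starBelow_singleton C1 sigma1 (by decide)) C1.N (List.Sublist.refl _)
    (fun _ hcn _ => hcn)
  have e1 : (C1.P.map Prod.snd).sum = 1 := by decide
  have e2 : (C1.N.map Prod.snd).sum = 2 := by decide
  rw [e1, e2] at h1
  omega

/-- `C2` (ample leg) violates even the star row at every surplus `≥ 3`. -/
theorem not_hallPlusStarUp_C2 {k : ℕ} (hk : 3 ≤ k) : ¬ HallPlusStarUp C2 k := by
  intro h
  have h1 := h C2.P (List.Sublist.refl _) (by decide) (starBelow_singleton C2 sigma2 (by decide)) C2.N (List.Sublist.refl _)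
    (fun _ hcn _ => hcn)
  have e1 : (C2.P.map Prod.snd).sum = 1 := by decide
  have e2 : (C2.N.map Prod.snd).sum = 3 := by decide
  rw [e1, e2] at h1
  omega

/-- neither `C1` nor `C2` is leg-free. -/
theorem not_entrySharp_C1_C2 : ¬ EntrySharp C1 ∧ ¬ EntrySharp C2 :=
  ⟨fun h => not_live.1 (h (sigma1, 1) (List.mem_singleton.2 rfl) (tau1, 2) (List.mem_singleton.2 rfl) weakLive_sigma1_tau1),
   fun h => not_live.2 (h (sigma2, 1) (List.mem_singleton.2 rfl) (hub4h14, 3) (List.mem_singleton.2 rfl) weakLive_sigma2_hub)⟩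

/-! ## §2 A leg-free NON-STAR pattern: `D3` (height 14, in scope)

Columns `σ₁ = (10;2,2)⁴ × 2`, `σ₂ = (10;−2,−2)⁴ × 2`; receivers `τ₁ = (12;1,1)⁴ × 1` (four-ample above `σ₁`, DEAD above `σ₂`), `τ₂ = (12;−1,−1)⁴ × 1`
(the mirror), `hub⁴ × 9` (four-ample above both).  Every weakly-live entry pair is four-ample (`entrySharp_D3`); every one-column condition of
PortHall₈ holds with margin exactly 8 (`2 + 8 ≤ 1 + 9`), the two-column set `{σ₁, σ₂}` has NO star (`not_starBelow_D3`) and violates PortHall₈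
(`4 + 8 ≤ 11` fails: `not_hallPlusUp_eight_D3`), so `D3` separates `HallPlusStarUp · 8` from PortHall₈ at the level of ROWS.  LAW PP decides the
design: `ppCleanB weakB D3 = false` (`D3_kernel`; the degree-8 digit of `c(τ₁ + τ₂ + 9·hub⁴ − 2σ₁ − 2σ₂)` is `114 227 675 136 · pt⁴ ≠ 0` by the
stdlib recomputation in the memo), i.e. on this pattern PP CONFIRMS PortHall₈'s pair condition. -/

/-- column letters `(10; ±2, ±2)` and private receiver letters `(12; ±1, ±1)`, height 14. -/
def lS1 : Letter := ⟨10, 2, 2⟩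
def lS2 : Letter := ⟨10, -2, -2⟩
def lT1 : Letter := ⟨12, 1, 1⟩
def lT2 : Letter := ⟨12, -1, -1⟩
def dS1 : Cell := cellOf lS1 lS1 lS1 lS1
def dS2 : Cell := cellOf lS2 lS2 lS2 lS2
def dT1 : Cell := cellOf lT1 lT1 lT1 lT1
def dT2 : Cell := cellOf lT2 lT2 lT2 lT2

/-- **D3**. -/
def D3 : Design := { N := [(dT1, 1), (dT2, 1), (hub4h14, 9)], P := [(dS1, 2), (dS2, 2)] }

theorem D3_rank : D3.rank = 7 ∧ D3.copies = 15 := by decide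

/-- the four live entry pairs are four-ample … -/
theorem D3_live : Live dS1 dT1 ∧ Live dS1 hub4h14 ∧ Live dS2 dT2 ∧ Live dS2 hub4h14 :=
  ⟨(liveB_iff _ _).1 (by decide), (liveB_iff _ _).1 (by decide), (liveB_iff _ _).1 (by decide), (liveB_iff _ _).1 (by decide)⟩

/-- … and the two crossing pairs are dead (zero entries). -/
theorem D3_dead : ¬ WeakLive dS1 dT2 ∧ ¬ WeakLive dS2 dT1 := by
  constructor <;>
  · intro h
    have hb := weakLiveB_of h
    revert hb
    decide

/-- **`D3` is leg-free.** -/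
theorem entrySharp_D3 : EntrySharp D3 := by
  intro cm hcm cn hcn hw
  have hcm' : cm = (dS1, 2) ∨ cm = (dS2, 2) := by simpa [D3] using hcm
  have hcn' : cn = (dT1, 1) ∨ cn = (dT2, 1) ∨ cn = (hub4h14, 9) := by simpa [D3] using hcn
  rcases hcm' with rfl | rfl <;> rcases hcn' with rfl | rfl | rfl
  · exact D3_live.1
  · exact absurd hw D3_dead.1
  · exact D3_live.2.1
  · exact absurd hw D3_dead.2
  · exact D3_live.2.2.1
  · exact D3_live.2.2.2

/-- SCOPE rows: height-14 alphabet, disjoint supports. -/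
theorem D3_scope : D3.OnAlphabet 14 ∧ Disj D3 := by
  constructor
  · intro c hc f
    have hc' : c = dT1 ∨ c = dT2 ∨ c = hub4h14 ∨ c = dS1 ∨ c = dS2 := by simpa [D3, Design.suppN, Design.suppP] using hc
    rcases hc' with rfl | rfl | rfl | rfl | rfl <;> fin_cases f <;> exact ⟨by decide, by decide⟩
  · intro c hN hP
    have h1 : c = dT1 ∨ c = dT2 ∨ c = hub4h14 := by simpa [D3, Design.suppN] using hN
    have h2 : c = dS1 ∨ c = dS2 := by simpa [D3, Design.suppP] using hP
    rcases h2 with rfl | rfl <;> rcases h1 with h | h | h <;> exact absurd (congrFun h 0) (by decide)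

/-- **`D3` violates PortHall₈** at the two-column set `S = P` (`4 + 8 ≤ 11` fails) … -/
theorem not_hallPlusUp_eight_D3 : ¬ HallPlusUp D3 8 := by
  intro h
  have h1 := h D3.P (List.Sublist.refl _) (by decide) D3.N (List.Sublist.refl _) (fun _ hcn _ => hcn)
  have e1 : (D3.P.map Prod.snd).sum = 4 := by decide
  have e2 : (D3.N.map Prod.snd).sum = 11 := by decide
  rw [e1, e2] at h1
  omega

/-- … hence (leg-free) violates the leg row too … -/
theorem not_hallPlusLegUp_D3 : ¬ HallPlusLegUp D3 :=
  fun h => not_hallPlusUp_eight_D3 (hallPlusUp_eight_of_hallPlusLegUp D3 entrySharp_D3 h)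

/-- … and that column set has NO star (each column is dead below the other's private receiver). -/
theorem not_starBelow_D3 : ¬ StarBelow D3 D3.P := by
  rintro ⟨cs, hcs, _, hall⟩
  have hcs' : cs = (dS1, 2) ∨ cs = (dS2, 2) := by simpa [D3] using hcs
  rcases hcs' with rfl | rfl
  · exact D3_dead.1 (hall (dT2, 1) (by simp [D3]) ⟨(dS2, 2), by simp [D3], weakLive_of_live _ _ D3_live.2.2.1⟩)
  · exact D3_dead.2 (hall (dT1, 1) (by simp [D3]) ⟨(dS1, 2), by simp [D3], weakLive_of_live _ _ D3_live.1⟩)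

/-- **KERNEL (hsemireg-monad-3 g16's LAW-PP engine, `decide +kernel`)**: LAW PP REFUTES `D3` (no split block with this letter design has a
locally free cokernel, whatever the maps); its Hall margin over closed receiver sets is `7` (attained only at the full set); PortHall₇ holds and
PortHall₈ fails on closed receiver sets.  So on this leg-free non-star pattern LAW PP implies PortHall₈'s pair condition. -/
theorem D3_kernel : ppCleanB weakB D3 = false ∧ hallMargin weakB D3 = some 7 ∧ portHallB weakB D3 7 = true ∧ portHallB weakB D3 8 = false := by
  decide +kernel

theorem not_ppClean_D3 : ¬ PPClean weakB D3 := by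
  rw [PPClean, D3_kernel.1]
  decide

theorem not_portHall_eight_D3 : ¬ PortHall weakB D3 8 := by
  rw [PortHall, D3_kernel.2.2.2]
  decide

/-- SUMMARY of §2. -/
theorem star_row_separated :
    EntrySharp D3 ∧ ¬ StarBelow D3 D3.P ∧ ¬ HallPlusUp D3 8 ∧ ¬ HallPlusLegUp D3 ∧ ¬ PPClean weakB D3 :=
  ⟨entrySharp_D3, not_starBelow_D3, not_hallPlusUp_eight_D3, not_hallPlusLegUp_D3, not_ppClean_D3⟩

/-! ## Audit: nothing is decided here

`StarBelow`, `HallPlusStarUp` are `Prop`s on letter designs; `D3` is a fifteen-copy letter design, not a seed (no claim about `A1`, RULE D, `μ`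
or the budget).  The geometric theorem that makes the star row rigorous on leg-free split blocks is PEN (module docstring, memo §2), cited, not
formalised.  Every theorem here is an implication between rows or a `decide` on a closed term. -/

end Summit.HodgeConjecture.HodgeConjecture.Cruxes.BlochSeedDiscOne.PortHallLeg
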